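import Summits.CriticalPhenomena.Ising3DConformalLimit.Theses.PrimaryAtInfinity
import Summits.CriticalPhenomena.Ising3DConformalLimit.Theses.WeylWindow
import Summits.CriticalPhenomena.Ising3DConformalLimit.Theses.PerfectScreening
import Summits.CriticalPhenomena.Ising3DConformalLimit.Theorems.MoebiusLimitExists.Negative.MeshContinuity
import Summits.CriticalPhenomena.Ising3DConformalLimit.Theorems.MoebiusLimitExists.Negative.FreeReflections
import HarnessLib

/-!
# Item 5355 `ExistsRegularLimit` is bare existence (item 4738 `LimitExists`): the regularity package is free
# (crux stmt-CriticalPhenomena-4801 `MoebiusLimitOfTwoPointLaw`, line `multipole-ward-nonsat-endpoint`, lead c2,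
# stub `stub_regularOfLimitExists`)

The line's dependency edge takes item stmt-CriticalPhenomena-5355 `PrimaryAtInfinity.ExistsRegularLimit`
(existence of a pointwise scaling limit of `criticalCorr 3` that is normalised off `NonCoincident`,
non-degenerate, translation invariant, parity invariant and continuous off the diagonals). Every one of the
four regularity clauses is AUTOMATIC for a pointwise scaling limit of the critical `ℤ³` correlators:

* normalisation — truncate to `0` off `NonCoincident` (the limit only sees non-coincident configurations:
  `TendstoLocallyUniformlyOn.congr_right`);
* translation invariance — `MoebiusLimitExistsNegative.limit_translate` (lattice translation invariance of
  the plus state at `β_c`, meshes `t/(k+1)`; Friedli–Velenik 2017 Thm. 3.17);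
* parity `S n (−x) = S n x` — `MoebiusLimitExistsNegative.limit_neg` (lattice point reflection, generic
  translate so that no coordinate sits on the grid; Friedli–Velenik 2017 Ex. 3.14);
* continuity on `NonCoincident` — `LimitMeshContinuity.continuousOn_limit` (the "good mesh" argument:
  nearby configurations share a product of `δ`-cells for a positive-measure set of meshes).

Hence `WeylWindow.LimitExists` (item stmt-CriticalPhenomena-4738: `∃ ρ S`, `ρ > 0` on `(0,1]`,
`HasPointwiseScalingLimit (criticalCorr 3) ρ S`, `IsNondegenerateTwoPoint S`) already gives `ExistsRegularLimit`
(`stub_regularOfLimitExists`), and the two items are equivalent (`existsRegularLimit_iff_limitExists`).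
For the crux this trades hypothesis 5355 for the weakest existence item of the sub-problem, which is also
NECESSARY for the crux's conclusion (item 1344 ⇒ 4738, `limitExists_of_moebiusLimitExists`).
-/

noncomputable section

namespace Summit.CriticalPhenomena.Ising3DConformalLimit.PrecisionLaplacianMoebiusLimitOfTwoPointLaw

open Literature.Probability.LatticeModels Filter Topology
open Summit.CriticalPhenomena.Ising3DConformalLimit.Theses
open Summit.CriticalPhenomena.Ising3DConformalLimit.MoebiusLimitExistsNegative
  (limit_translate limit_neg add_mem_nonCoincident_iff)

/-- Negating every point preserves non-coincidence. [folklore] -/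
theorem rle_neg_mem_nonCoincident_iff {n : ℕ} (x : Fin n → EuclideanSpace ℝ (Fin 3)) :
    (fun i => -x i) ∈ NonCoincident 3 n ↔ x ∈ NonCoincident 3 n := by
  rw [mem_nonCoincident, mem_nonCoincident]
  exact neg_injective.of_comp_iff x

open Classical in
/-- **The regularity package of a pointwise scaling limit of `criticalCorr 3` is free.** For ANY pointwise
scaling limit `S` (any renormalisation `ρ`), the truncated family `S' := S` on `NonCoincident`, `0` off it, is
again a pointwise scaling limit with the same `ρ`, agrees with `S` on `NonCoincident`, vanishes off
`NonCoincident`, is translation invariant, parity invariant, and continuous on `NonCoincident`.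
[cite: FriedliVelenik2017, Thm. 3.17 and Ex. 3.14] (lattice symmetries of the plus state; the limit
statements are the tree's `limit_translate`, `limit_neg`, `continuousOn_limit`). -/
theorem regular_of_hasPointwiseScalingLimit {ρ : ℝ → ℝ} {S : CorrFamily 3}
    (hlim : HasPointwiseScalingLimit (criticalCorr 3) ρ S) :
    HasPointwiseScalingLimit (criticalCorr 3) ρ
        (fun n x => if x ∈ NonCoincident 3 n then S n x else 0) ∧
      (∀ n, Set.EqOn (fun x => if x ∈ NonCoincident 3 n then S n x else 0) (S n) (NonCoincident 3 n)) ∧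
      (∀ n z, z ∉ NonCoincident 3 n → (if z ∈ NonCoincident 3 n then S n z else 0) = 0) ∧
      IsTranslationInvariant (fun n x => if x ∈ NonCoincident 3 n then S n x else 0) ∧
      (∀ n (x : Fin n → EuclideanSpace ℝ (Fin 3)),
        (if (fun i => -x i) ∈ NonCoincident 3 n then S n (fun i => -x i) else 0) =
          if x ∈ NonCoincident 3 n then S n x else 0) ∧
      (∀ n, ContinuousOn (fun x => if x ∈ NonCoincident 3 n then S n x else 0) (NonCoincident 3 n)) := by
  have heq : ∀ n, Set.EqOn (fun x => if x ∈ NonCoincident 3 n then S n x else 0) (S n)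
      (NonCoincident 3 n) := fun n x hx => if_pos hx
  have hlim' : HasPointwiseScalingLimit (criticalCorr 3) ρ
      (fun n x => if x ∈ NonCoincident 3 n then S n x else 0) :=
    fun n => (hlim n).congr_right (heq n).symm
  refine ⟨hlim', heq, fun n z hz => if_neg hz, ?_, ?_, ?_⟩
  · intro n v x
    by_cases hx : x ∈ NonCoincident 3 n
    · simp only [if_pos ((add_mem_nonCoincident_iff v x).2 hx), if_pos hx, limit_translate hlim v hx]
    · simp only [if_neg (mt (add_mem_nonCoincident_iff v x).1 hx), if_neg hx]
  · intro n x
    by_cases hx : x ∈ NonCoincident 3 n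
    · simp only [if_pos ((rle_neg_mem_nonCoincident_iff x).2 hx), if_pos hx, limit_neg hlim hx]
    · simp only [if_neg (mt (rle_neg_mem_nonCoincident_iff x).1 hx), if_neg hx]
  · intro n
    exact Summit.CriticalPhenomena.Ising3DConformalLimit.LimitMeshContinuity.continuousOn_limit hlim' n

open Classical in
/-- **Stub `stub_regularOfLimitExists` (line `multipole-ward-nonsat-endpoint`, lead c2): item
stmt-CriticalPhenomena-4738 `WeylWindow.LimitExists` ⇒ item stmt-CriticalPhenomena-5355
`PrimaryAtInfinity.ExistsRegularLimit`.** Bare existence of a non-degenerate pointwise scaling limit of the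
critical `ℤ³` correlators already yields a REGULAR one (normalised, translation and parity invariant,
continuous off the diagonals): take the truncation of the same limit. [cite: FriedliVelenik2017, Thm. 3.17] -/
theorem stub_regularOfLimitExists : WeylWindow.LimitExists → PrimaryAtInfinity.ExistsRegularLimit := by
  rintro ⟨ρ, S, hρ, hlim, hnd⟩
  obtain ⟨hlim', heq, hnorm, htr, hpar, hcont⟩ := regular_of_hasPointwiseScalingLimit hlim
  refine ⟨ρ, fun n x => if x ∈ NonCoincident 3 n then S n x else 0, hρ, hlim', hnorm, ?_, htr, hpar,
    hcont⟩
  intro x hx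
  show 0 < (if x ∈ NonCoincident 3 2 then S 2 x else 0)
  rw [if_pos hx]
  exact hnd x hx

/-- **Items 5355 and 4738 are equivalent**: `PrimaryAtInfinity.ExistsRegularLimit ↔ WeylWindow.LimitExists`
(the forward direction forgets the regularity clauses). [cite: FriedliVelenik2017, Thm. 3.17] -/
theorem existsRegularLimit_iff_limitExists :
    PrimaryAtInfinity.ExistsRegularLimit ↔ WeylWindow.LimitExists :=
  ⟨fun ⟨ρ, S, hρ, hlim, _, hnd, _, _, _⟩ => ⟨ρ, S, hρ, hlim, hnd⟩, stub_regularOfLimitExists⟩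

/-- **Item 4738 is necessary for the crux's conclusion**: item stmt-CriticalPhenomena-1344
`PerfectScreening.MoebiusLimitExists` ⇒ `WeylWindow.LimitExists` (forget `Δ` and the Möbius covariance).
[folklore] -/
theorem limitExists_of_moebiusLimitExists :
    PerfectScreening.MoebiusLimitExists → WeylWindow.LimitExists :=
  fun ⟨ρ, _, S, hρ, _, hlim, hnd, _⟩ => ⟨ρ, S, hρ, hlim, hnd⟩

end Summit.CriticalPhenomena.Ising3DConformalLimit.PrecisionLaplacianMoebiusLimitOfTwoPointLaw

end
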